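import Summits.BirchSwinnertonDyer.BirchSwinnertonDyer.Theorems.TeichmullerTwistDescentKOfCarrierOnly
import HarnessLib

/-!
# Route `TeichmullerTwistDescent`, crux K `TwistedPeriodLatticeSaturation` (stmt-BirchSwinnertonDyer-25368):
# the ONE remaining input of the K-line, NAMED — `IntegralTameTypeCarrierFunctional` — and K from it

Cell `pub/bsd-wall` (D-0145 line route-BirchSwinnertonDyer-TeichmullerTwistDescent, OPEN rev 7), seat `bsd-line-ttd-p1`
(prover 1/2, g24).  ONE DEFINITION (a closed `Prop`, the hypothesis `hcar` of
`KOfCarrierOnly.twistedPeriodLatticeSaturation_of_carrierFunctional`, verbatim — an object the route posits, asserting nothing)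
and ONE THEOREM (K from modularity and that `Prop`).  No named literature fact, no `sorry`, no instance, no notation.  BSD is not
proved by this file; K is NOT proved by this file (it is proved CONDITIONALLY on `exists_isNewformOf` and
`IntegralTameTypeCarrierFunctional`); nothing here closes an item.  Purpose: give the planner a NAME for the single open input of the
K-line so that it can be filed as a statement item / typed from the literature (Emerton–Gee–Savitt 2015, Breuil's lattice
conjecture; Le–Morra–Schraen 2016, multiplicity one at full congruence level — see the seat memo §6b).

`IntegralTameTypeCarrierFunctional` says: for every elliptic `W/ℚ` of conductor `p²M` (`p ∤ M`), globally minimal, with modular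
parametrisation datum `D`, `p ≥ 11`, additive at `p`, `E[p]` irreducible, (G)-ordinary, `v_p(Δ_min) ≤ 4`, there are `0 < b`,
`2b < p − 1`, `m`, and a `ℤ_p`-linear functional `Ψ` on the spread lattice `Λ_Q(f_D)` of the full-level carrier
`H₁(Γ₀(M), ℤ_p[GL₂(ℤ/p)])`, equivariant for `coordRep(ω̃^{p−1−b}, ω̃^b)`, with `p^m·(everything) ⊆ range Ψ` and reduction socle
`⊆ Sym^{2b} ⊗ det^{−b}` (`ReductionSocleLe` over `ℤ/p`).
-/

set_option linter.dupNamespace false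

noncomputable section

open scoped Pointwise MatrixGroups TensorProduct

open Function CongruenceSubgroup
open Literature.RepresentationTheory.FiniteGroups Literature.RepresentationTheory.FiniteGroups.GL2
  Literature.NumberTheory.EllipticCurves.ModularForms
open Literature.NumberTheory.EllipticCurves (Kato2004.teichmullerChar)
open Literature.NumberTheory.ModularSymbols Literature.NumberTheory.ModularSymbols.FullLevel
open Literature.Algebra.Homology

namespace Summit.BirchSwinnertonDyer.BirchSwinnertonDyer.Theorems.TeichmullerTwistDescent

open WeierstrassCurve Literature.NumberTheory.EllipticCurves

/-- **The integral tame-type carrier functional** (the one remaining input of the K-line; hypothesis `hcar` of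
`KOfCarrierOnly.twistedPeriodLatticeSaturation_of_carrierFunctional`, verbatim): for every curve of conductor `p²M` in the
situation of K there is an equivariant `ℤ_p`-functional from the spread lattice of the full-level carrier to the principal-series
model `coordRep(ω̃^{p−1−b}, ω̃^b)` with finite-index image whose reduction has socle `⊆ Sym^{2b} ⊗ det^{−b}`.  A closed `Prop`,
a ROUTE-POSITED HYPOTHESIS (not a published statement; the literature it should eventually follow from is Emerton–Gee–Savitt 2015
and Le–Morra–Schraen 2016, see the module docstring); asserts nothing. -/
def IntegralTameTypeCarrierFunctional : Prop :=
  ∀ (p M : ℕ) [Fact p.Prime] [NeZero M] [NeZero (p ^ 2 * M)] (hpM : Nat.Coprime p M)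
  [Fintype (diagTorus (ZMod p))] [Invertible (Fintype.card (diagTorus (ZMod p)) : ℤ_[p])]
  (W : WeierstrassCurve ℚ) [W.IsElliptic] [W.IsGloballyMinimal], W.conductorNorm ℤ = p ^ 2 * M →
  ∀ D : ModularParametrizationData W (p ^ 2 * M), 11 ≤ p → Rank1Residual.Addv W p → Rank1Residual.Irr W p →
  Summit.BirchSwinnertonDyer.Rank1Residual.Additive.TypeGOrd W p → padicValInt p W.minimalDiscriminantInt ≤ 4 →
  ∃ (b m : ℕ) (Ψ : spreadLattice ℤ_[p] p M hpM D.f →ₗ[ℤ_[p]] (Option (ZMod p) → ℤ_[p])),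
  0 < b ∧ 2 * b < p - 1 ∧
  IsEquivariantOnSpread ℤ_[p] p M hpM D.f
  (coordRep (Kato2004.teichmullerChar p ^ (p - 1 - b)) (Kato2004.teichmullerChar p ^ b)) Ψ ∧
  (∀ v : Option (ZMod p) → ℤ_[p], (p : ℤ_[p]) ^ m • v ∈ LinearMap.range Ψ) ∧
  ∀ Λ' : Subrepresentation (coordRep (Kato2004.teichmullerChar p ^ (p - 1 - b)) (Kato2004.teichmullerChar p ^ b)),
  Λ'.toSubmodule = LinearMap.range Ψ →
  @ReductionSocleLe p _ (ZMod p) _ _ (PadicInt.toZMod (p := p)).toAlgebra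
  (Kato2004.teichmullerChar p ^ (p - 1 - b)) (Kato2004.teichmullerChar p ^ b) (2 * b) Λ'

/-- **K from modularity and `IntegralTameTypeCarrierFunctional`.**  The conclusion is the route decl
`TwistedPeriodLatticeSaturation` VERBATIM; BSD is not proved by this; K is proved CONDITIONALLY on the two named hypotheses
(`KOfCarrierOnly.twistedPeriodLatticeSaturation_of_carrierFunctional`, unfolded). [cite: EdixhovenManin1991, §4]
[cite: EmertonGeeSavitt2015, Lemma 4.1.1] -/
theorem twistedPeriodLatticeSaturation_of_integralTameTypeCarrierFunctional (hnf : exists_isNewformOf)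
    (hcar : IntegralTameTypeCarrierFunctional) :
    Summit.BirchSwinnertonDyer.BirchSwinnertonDyer.Theses.TeichmullerTwistDescent.TwistedPeriodLatticeSaturation :=
  KOfCarrierOnly.twistedPeriodLatticeSaturation_of_carrierFunctional hnf hcar

/-! ### Appended (g25): the SPLIT of `IntegralTameTypeCarrierFunctional` into a rational functional and a
mod-`p` weight-exclusion statement

The reduction-socle clause of `IntegralTameTypeCarrierFunctional` is NOT an independent «Breuil-lattice» input: an
equivariant functional `Ψ : Λ_Q(f) → L` onto a finite-index sublattice of the standard lattice
`L = Fun_{ℤ_p}(Ind(ω̃^{p−1−b} ⊗ ω̃ᵇ))` has image `pᶜ·L` or `pᶜ·L₁` (`L ⊋ L₁ ⊋ pL`, `L₁/pL` the socle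
`Sym^{2b} ⊗ det^{−b}` of `L/pL`), and the second alternative makes `Λ_Q(f)` map ONTO the simple module
`Sym^{2b}(𝔽_p²) ⊗ (ω^{−b} ∘ det)` — a weight that the UNSTARRED potentially ordinary curve does not have
(`ρ̄_W|I_p ∼ (ω^{1−b} ∗; 0 ωᵇ)`, Serre weight `Sym^{p−1−2b} ⊗ detᵇ` only: Ash–Stevens 1986 Thm. 3.5, Deligne /
Fontaine via Edixhoven 1992 Thms. 2.5–2.6).  Hence `IntegralTameTypeCarrierFunctional` ⟸
`RationalTameTypeCarrierFunctional ∧ NoEtaleWeightQuotient` (theorem file `TeichmullerTwistDescentKOfWeightExclusion`),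
with the exponent made EXPLICIT: `tameExponent p W = (p − 1)·ord_pΔ_min/12` (`= (p−1)/e`, `e = 6, 4, 3` on Kodaira
II, III, IV).  Three definitions, asserting nothing. -/

/-- **The tame exponent** `b := (p − 1)·ord_p(Δ_min)/12` of a globally minimal curve at `p`: on a Kodaira II / III /
IV fibre (`ord_pΔ_min = 2, 3, 4`, semistability defect `e = 6, 4, 3`) with `e ∣ p − 1` this is `(p − 1)/e`, the
exponent of the character `ωᵇ` through which inertia acts on the étale quotient of `E[p]` (the action of
`Aut(Ẽ) ∋ ζ_e` on the good tame model), so that `ρ̄_W|I_p ∼ (ω^{1−b} ∗; 0 ωᵇ)` and the tame type of `f_W` at `p`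
is `Ind(ω̃^{−b} ⊗ ω̃ᵇ)`.  A bare arithmetic definition (asserts nothing). [cite: Serre1972PointsOrdreFini, §1.11–1.12]
[cite: Edixhoven1992, §2] -/
def tameExponent (p : ℕ) (W : WeierstrassCurve ℚ) [W.IsGloballyMinimal] : ℕ :=
  (p - 1) * padicValInt p W.minimalDiscriminantInt / 12

/-- **The rational tame-type carrier functional** (input (I1″) of the K-line): `IntegralTameTypeCarrierFunctional`
WITHOUT its reduction-socle clause and with the exponent EXPLICIT (`b = tameExponent p W`, `0 < b`, `2b < p − 1`):
for every curve of conductor `p²M` in the situation of K there is a `ℤ_p`-linear functional `Ψ` on the spread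
lattice `Λ_Q(f_D)` of the full-level carrier, equivariant for `coordRep(ω̃^{p−1−b}, ω̃ᵇ)`, whose image has finite
index.  This is the AUTOMORPHIC-TYPE statement «the `f_W`-part of `H₁(Y(K(p)K₀(M)), ℚ_p)` contains the tame
principal series `Ind(ω̃^{−b} ⊗ ω̃ᵇ)` of `GL₂(𝔽_p)`» (local Langlands at `p` for the potentially ordinary curve +
newform theory), equivalently «the Teichmüller twist `f_W ⊗ ω̃^{±b}` has level `pM`».  A closed `Prop`, a
ROUTE-POSITED HYPOTHESIS (not a published statement — the literature it should follow from is local Langlands /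
Carayol at `p` for the twisted newform plus Ash–Stevens 1986 §1; no cite tag on purpose); asserts nothing. -/
def RationalTameTypeCarrierFunctional : Prop :=
  ∀ (p M : ℕ) [Fact p.Prime] [NeZero M] [NeZero (p ^ 2 * M)] (hpM : Nat.Coprime p M)
  [Fintype (diagTorus (ZMod p))] [Invertible (Fintype.card (diagTorus (ZMod p)) : ℤ_[p])]
  (W : WeierstrassCurve ℚ) [W.IsElliptic] [W.IsGloballyMinimal], W.conductorNorm ℤ = p ^ 2 * M →
  ∀ D : ModularParametrizationData W (p ^ 2 * M), 11 ≤ p → Rank1Residual.Addv W p → Rank1Residual.Irr W p →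
  Summit.BirchSwinnertonDyer.Rank1Residual.Additive.TypeGOrd W p → padicValInt p W.minimalDiscriminantInt ≤ 4 →
  0 < tameExponent p W ∧ 2 * tameExponent p W < p - 1 ∧
  ∃ (m : ℕ) (Ψ : spreadLattice ℤ_[p] p M hpM D.f →ₗ[ℤ_[p]] (Option (ZMod p) → ℤ_[p])),
  IsEquivariantOnSpread ℤ_[p] p M hpM D.f
    (coordRep (Kato2004.teichmullerChar p ^ (p - 1 - tameExponent p W))
      (Kato2004.teichmullerChar p ^ tameExponent p W)) Ψ ∧
  ∀ v : Option (ZMod p) → ℤ_[p], (p : ℤ_[p]) ^ m • v ∈ LinearMap.range Ψ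

/-- **No étale-weight quotient** (input (W″) of the K-line, the SERRE-WEIGHT EXCLUSION): for every curve of
conductor `p²M` in the situation of K, with `b = tameExponent p W`, every `ℤ_p`-linear map from the spread lattice
`Λ_Q(f_D)` to the simple `𝔽_p[GL₂(𝔽_p)]`-module `Sym^{2b}(𝔽_p²) ⊗ (ω^{−b} ∘ det)` (the model `symPowTwist` with
`χ̄₁ = reduction of ω̃^{p−1−b}`, scalars restricted along `ℤ_p → 𝔽_p`) which intertwines right translation of
functions with the group action is ZERO.  Mathematically: `Sym^{2b} ⊗ det^{−b}` is not a Serre weight of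
`ρ̄_W` (`ρ̄_W|I_p ∼ (ω^{1−b} ∗; 0 ωᵇ)` on the unstarred potentially ordinary types), so it does not occur in the
`f_W`-part of `H¹(Y(K(p)K₀(M)), 𝔽̄_p)` (Ash–Stevens 1986 Thm. 3.5 + Deligne / Fontaine via Edixhoven 1992 Thms. 2.5–2.6
+ the inertia computation on the tame good model).  A closed `Prop`, a ROUTE-POSITED HYPOTHESIS (not a published
statement; no cite tag on purpose); asserts nothing. -/
def NoEtaleWeightQuotient : Prop :=
  ∀ (p M : ℕ) [Fact p.Prime] [NeZero M] [NeZero (p ^ 2 * M)] (hpM : Nat.Coprime p M)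
  [Fintype (diagTorus (ZMod p))] [Invertible (Fintype.card (diagTorus (ZMod p)) : ℤ_[p])]
  (W : WeierstrassCurve ℚ) [W.IsElliptic] [W.IsGloballyMinimal], W.conductorNorm ℤ = p ^ 2 * M →
  ∀ D : ModularParametrizationData W (p ^ 2 * M), 11 ≤ p → Rank1Residual.Addv W p → Rank1Residual.Irr W p →
  Summit.BirchSwinnertonDyer.Rank1Residual.Additive.TypeGOrd W p → padicValInt p W.minimalDiscriminantInt ≤ 4 →
  letI : Algebra ℤ_[p] (ZMod p) := (PadicInt.toZMod (p := p)).toAlgebra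
  ∀ Φ : spreadLattice ℤ_[p] p M hpM D.f →ₗ[ℤ_[p]]
    ↥(MvPolynomial.homogeneousSubmodule (Fin 2) (ZMod p) (2 * tameExponent p W)),
  IsEquivariantOnSpread ℤ_[p] p M hpM D.f
    (Literature.NumberTheory.Automorphic.TwistedQuotient.resScalars ℤ_[p]
      (symPowTwist (ZMod.castHom (dvd_refl p) (ZMod p))
        (reduceChar (ZMod p) (Kato2004.teichmullerChar p ^ (p - 1 - tameExponent p W)))
        (2 * tameExponent p W))) Φ →
  Φ = 0

/-! ### Appended (g25, second): the Ash–Stevens form (W‴) of the weight exclusion — on the CARRIER, Hecke-eigen, no period data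

(W″) quantifies over functionals on the spread lattice `Λ_Q(f_D) = range (spreadPeriod f_D)`, a `G`-quotient of the carrier
`C = H₁(Γ₀(M), ℤ_p[GL₂(𝔽_p)])` on which every `T_q` (`q ≠ p` prime) acts through `a_q(W)` (`spreadPeriod_heckeT`).  Pulling back
along `C ↠ Λ_Q` gives the form a typer can attack with Ash–Stevens 1986 directly (group homology of `Γ₀(M)` with coefficients in
`ℤ_p[GL₂(𝔽_p)]`, Hecke operators `heckeT`, eigenvalues `a_q(W) = W.LFunction q`): NO `G`-equivariant `ℤ_p`-linear map from the
carrier to `Sym^{2b}(𝔽_p²) ⊗ (ω^{−b} ∘ det)` is Hecke-eigen for `W` unless it is zero.  (W‴) ⟹ (W″)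
(`KOfWeightExclusion.noEtaleWeightQuotient_of_noEtaleWeightEigenQuotient`).  One definition, asserting nothing. -/

/-- **No étale-weight Hecke-eigen quotient of the full-level carrier** (input (W‴) of the K-line, the Ash–Stevens form of
(W″)): for every curve `W` of conductor `p²M` in the situation of K, with `b = tameExponent p W`, every `ℤ_p`-linear map `Θ`
from the carrier `H₁(Γ₀(M), ℤ_p[GL₂(𝔽_p)])` to `Sym^{2b}(𝔽_p²) ⊗ (ω^{−b} ∘ det)` which is `GL₂(𝔽_p)`-equivariant
(`Θ(g·z) = g·Θ(z)`) and HECKE-EIGEN FOR `W` (`Θ(T_q z) = a_q(W)·Θ(z)` for every prime `q ≠ p`, `a_q(W) = W.LFunction q`) is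
ZERO.  Mathematically: the eigensystem of `ρ̄_W` does not occur in `H₁(Γ₀(M), Sym^{2b} ⊗ det^{−b})` (Ash–Stevens 1986 Thm. 3.5
⟹ `ρ̄_W ⊗ ω^b` modular of weight `2b + 2 ≤ p` and level prime to `p` ⟹ Deligne / Fontaine (Edixhoven 1992 Thms. 2.5–2.6)
`ρ̄_W ⊗ ω^b|I_p ∈ {(ω^{2b+1} ∗; 0 1), niveau 2}`, contradicting `ρ̄_W|I_p ∼ (ω^{1−b} ∗; 0 ω^b)` on the unstarred potentially
ordinary types).  A closed `Prop`, a ROUTE-POSITED HYPOTHESIS (not a published statement; no cite tag on purpose); asserts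
nothing. -/
def NoEtaleWeightEigenQuotient : Prop :=
  ∀ (p M : ℕ) [Fact p.Prime] [NeZero M] (W : WeierstrassCurve ℚ) [W.IsElliptic] [W.IsGloballyMinimal],
  W.conductorNorm ℤ = p ^ 2 * M → 11 ≤ p → Rank1Residual.Addv W p → Rank1Residual.Irr W p →
  Summit.BirchSwinnertonDyer.Rank1Residual.Additive.TypeGOrd W p → padicValInt p W.minimalDiscriminantInt ≤ 4 →
  letI : Algebra ℤ_[p] (ZMod p) := (PadicInt.toZMod (p := p)).toAlgebra
  ∀ Θ : H1carrier ℤ_[p] p M →ₗ[ℤ_[p]] ↥(MvPolynomial.homogeneousSubmodule (Fin 2) (ZMod p) (2 * tameExponent p W)),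
  (∀ (g : GL (Fin 2) (ZMod p)) (z : H1carrier ℤ_[p] p M),
      Θ (H1carrierRep ℤ_[p] p M g z) =
        symPowTwist (ZMod.castHom (dvd_refl p) (ZMod p))
          (reduceChar (ZMod p) (Kato2004.teichmullerChar p ^ (p - 1 - tameExponent p W)))
          (2 * tameExponent p W) g (Θ z)) →
  (∀ (q : ℕ) [NeZero q] (hq : q.Prime) (hqp : q ≠ p) (z : H1carrier ℤ_[p] p M),
      Θ (heckeT ℤ_[p] p M hq hqp z) = (((W.LFunction q : ℤ) : ZMod p)) • Θ z) →
  Θ = 0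

/-! ### Appended (g25, third): the Frobenius-reciprocity form (I1‴) of the rational functional — a nonzero
`(B, ω̃^{p−1−b} ⊗ ω̃ᵇ)`-EIGENFUNCTIONAL on the carrier, compatible with the spread of `f_D`

By Frobenius reciprocity (`Literature/…/GL2ModularPrincipalSeriesBorelEigenfunctional`: `frobeniusCoord`) an equivariant map
from the carrier `C = H₁(Γ₀(M), ℤ_p[GL₂(𝔽_p)])` to the Bruhat model of `Ind(ω̃^{p−1−b} ⊗ ω̃ᵇ)` is the same as a `ℤ_p`-valued
functional `λ` on `C` with `λ(β·z) = ω̃^{p−1−b}(β₀₀) ω̃ᵇ(β₁₁) λ(z)` for `β` in the Borel subgroup — a functional on the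
`(B, ψ)`-coinvariants of `C`, i.e. (Shapiro) on the homology of `Γ₀(pM)` with the NEBENTYPUS character `ψ`: the natural home of
the Teichmüller-twisted newform `f_W ⊗ ω̃^{±b}` of level `pM`.  (I1‴) asks for such a `λ ≠ 0` vanishing on `ker(spreadPeriod f_D)`
(the `f_D`-isotypic condition); NO finite-index / irreducibility clause is needed any more: (I1‴) ∧ (W‴) ⟹
`IntegralTameTypeCarrierFunctional` (`KOfBorelEigenfunctional.integralTameTypeCarrierFunctional_of_borel_of_noEtaleWeightEigenQuotient`,
Jacobson–Nakayama).  One definition, asserting nothing. -/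

/-- **Nonzero Borel eigenfunctional on the full-level carrier** (input (I1‴) of the K-line, the Frobenius-reciprocity form of
(I1″)): for every curve `W` of conductor `p²M` in the situation of K, with `b = tameExponent p W` (`0 < b`, `2b < p − 1`), there
is a NONZERO `ℤ_p`-linear functional `λ` on the carrier `H₁(Γ₀(M), ℤ_p[GL₂(𝔽_p)])` which is an eigenfunctional for the Borel
subgroup with character `β ↦ ω̃^{p−1−b}(β₀₀)·ω̃ᵇ(β₁₁)` (`borelCharacter`) and which vanishes on the kernel of the spread period map
of `f_D` (equivalently: factors through the K-line lattice `Λ_Q(f_D)`).  Mathematically: the `(B, ω̃^{−b} ⊗ ω̃ᵇ)`-coinvariants of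
the `f_W`-part of the full-level homology are nonzero — the nebentypus form `f_W ⊗ ω̃^{∓b}` of level `pM` exists (local Langlands /
Carayol at `p` for the potentially ordinary curve; Ash–Stevens / Shapiro).  A closed `Prop`, a ROUTE-POSITED HYPOTHESIS (not a
published statement; no cite tag on purpose); asserts nothing. -/
def NonzeroBorelEigenfunctional : Prop :=
  ∀ (p M : ℕ) [Fact p.Prime] [NeZero M] [NeZero (p ^ 2 * M)] (hpM : Nat.Coprime p M)
  [Fintype (diagTorus (ZMod p))] [Invertible (Fintype.card (diagTorus (ZMod p)) : ℤ_[p])]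
  (W : WeierstrassCurve ℚ) [W.IsElliptic] [W.IsGloballyMinimal], W.conductorNorm ℤ = p ^ 2 * M →
  ∀ D : ModularParametrizationData W (p ^ 2 * M), 11 ≤ p → Rank1Residual.Addv W p → Rank1Residual.Irr W p →
  Summit.BirchSwinnertonDyer.Rank1Residual.Additive.TypeGOrd W p → padicValInt p W.minimalDiscriminantInt ≤ 4 →
  0 < tameExponent p W ∧ 2 * tameExponent p W < p - 1 ∧
  ∃ lam : H1carrier ℤ_[p] p M →ₗ[ℤ_[p]] ℤ_[p], lam ≠ 0 ∧
    (∀ (β : borel (ZMod p)) (z : H1carrier ℤ_[p] p M),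
      lam (H1carrierRep ℤ_[p] p M (β : GL (Fin 2) (ZMod p)) z) =
        (borelCharacter (ZMod p) (Kato2004.teichmullerChar p ^ (p - 1 - tameExponent p W))
          (Kato2004.teichmullerChar p ^ tameExponent p W) β : ℤ_[p]) * lam z) ∧
    ∀ z : H1carrier ℤ_[p] p M, spreadPeriod ℤ_[p] p M hpM D.f z = 0 → lam z = 0

/-! ### Appended (g26): the WEAKEST automorphic input — a NONZERO equivariant map from the K-line lattice to the
tame principal series (I1⁰); no finite index, no Borel bookkeeping, no exponent inequalities

(I1″) asked for an equivariant `Ψ : Λ_Q(f_D) → L = Fun_{ℤ_p}(Ind(ω̃^{p−1−b} ⊗ ω̃ᵇ))` of FINITE INDEX together with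
`0 < b`, `2b < p − 1`; (I1‴) for a nonzero Borel eigenfunctional with the same inequalities.  The inequalities are now
theorems of the prefix (`TeichmullerTwistDescentTameExponent`: `13 ≤ p`, `e ∈ {3,4,6}`, `e·b = p − 1`), and a nonzero
equivariant `Ψ` already has a nonzero identity-coset coordinate at some translate, which is a Borel eigenfunctional
(`KOfPrincipalSeriesFunctional.nonzeroBorelEigenfunctional_of_tamePrincipalSeriesFunctional`; conversely Frobenius
reciprocity rebuilds `Ψ` from `λ`, so (I1⁰) ⟺ (I1‴)).  What is left is the bare representation-theoretic statement
«`Hom_{GL₂(𝔽_p)}(Λ_Q(f_W), Ind(ω̃^{−b} ⊗ ω̃ᵇ)) ≠ 0`», i.e. the tame principal series of `GL₂(𝔽_p)` OCCURS in the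
`f_W`-part of the full-level homology `H₁(Y(K(p)K₀(M)), ℚ_p)` — the shape in which local Langlands at `p` for the
potentially ordinary curve (inertia through `μ_e`, `e ∣ p − 1` ⟹ `π_{f_W,p} = PS(μ₁, μ₂)`, `μ_i|ℤ_pˣ = ω̃^{∓b}`) plus
Eichler–Shimura at level `K(p)K₀(M)` delivers it.  One definition, asserting nothing. -/

/-- **A nonzero equivariant functional to the tame principal series** (input (I1⁰) of the K-line, the weakest form of
(I1″)/(I1‴)): for every curve `W` of conductor `p²M` in the situation of K, with `b = tameExponent p W`, there is a
NONZERO `ℤ_p`-linear map `Ψ` from the spread lattice `Λ_Q(f_D)` of the full-level carrier `H₁(Γ₀(M), ℤ_p[GL₂(𝔽_p)])`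
to the Bruhat-coordinate model `coordRep(ω̃^{p−1−b}, ω̃ᵇ)` of `Ind(ω̃^{p−1−b} ⊗ ω̃ᵇ)` intertwining right translation of
functions with the group action (`IsEquivariantOnSpread`).  Mathematically: the tame principal series
`Ind(ω̃^{−b} ⊗ ω̃ᵇ)` of `GL₂(𝔽_p)` occurs in `Λ_Q(f_W) ⊗ ℚ̄_p` (⟸ `π_{f_W,p}` is the ramified principal series with
`μ_i|ℤ_pˣ = ω̃^{∓b}` and Eichler–Shimura at level `K(p)K₀(M)`); the order of the two characters is immaterial rationally
(`PS(χ₁, χ₂) ≅ PS(χ₂, χ₁)`).  A closed `Prop`, a ROUTE-POSITED HYPOTHESIS (not a published statement; no cite tag on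
purpose); asserts nothing. -/
def TamePrincipalSeriesFunctional : Prop :=
  ∀ (p M : ℕ) [Fact p.Prime] [NeZero M] [NeZero (p ^ 2 * M)] (hpM : Nat.Coprime p M)
  [Fintype (diagTorus (ZMod p))] [Invertible (Fintype.card (diagTorus (ZMod p)) : ℤ_[p])]
  (W : WeierstrassCurve ℚ) [W.IsElliptic] [W.IsGloballyMinimal], W.conductorNorm ℤ = p ^ 2 * M →
  ∀ D : ModularParametrizationData W (p ^ 2 * M), 11 ≤ p → Rank1Residual.Addv W p → Rank1Residual.Irr W p →
  Summit.BirchSwinnertonDyer.Rank1Residual.Additive.TypeGOrd W p → padicValInt p W.minimalDiscriminantInt ≤ 4 →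
  ∃ Ψ : spreadLattice ℤ_[p] p M hpM D.f →ₗ[ℤ_[p]] (Option (ZMod p) → ℤ_[p]),
  IsEquivariantOnSpread ℤ_[p] p M hpM D.f
    (coordRep (Kato2004.teichmullerChar p ^ (p - 1 - tameExponent p W))
      (Kato2004.teichmullerChar p ^ tameExponent p W)) Ψ ∧
  Ψ ≠ 0

/-! ### Appended (g26, second): the RATIONAL form (I1ℚ) — a nonzero equivariant map to the principal series over `ℚ_p`

(I1⁰) still asks for an INTEGRAL (`ℤ_p`-valued) map; any characteristic-zero source (Eichler–Shimura at level `K(p)K₀(M)`,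
Casselman's `K(p)`-invariants, local Langlands at `p`) delivers a `ℚ_p`- (or `ℚ̄_p`-) linear one.  Since `Λ_Q(f_D)` is a
finitely generated `ℤ_p`-module, denominators can be cleared (`KOfPrincipalSeriesFunctional.tamePrincipalSeriesFunctional_of_rat`:
(I1ℚ) ⟹ (I1⁰)), so the K-line's automorphic input becomes the purely rational statement
«`Hom_{ℤ_p[GL₂(𝔽_p)]}(Λ_Q(f_W), Ind(ω̃^{−b} ⊗ ω̃ᵇ) ⊗ ℚ_p) ≠ 0`».  One definition, asserting nothing. -/

/-- **A nonzero equivariant functional to the RATIONAL tame principal series** (input (I1ℚ) of the K-line): for every curve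
`W` of conductor `p²M` in the situation of K, with `b = tameExponent p W`, there is a NONZERO `ℤ_p`-linear map `Ψ` from the
spread lattice `Λ_Q(f_D)` to the `ℚ_p`-valued Bruhat-coordinate model `coordRep(ω̃^{p−1−b}, ω̃ᵇ) ⊗ ℚ_p` (characters pushed
into `ℚ_pˣ` by `reduceChar ℚ_[p]`, scalars restricted to `ℤ_p`) intertwining right translation of functions with the group
action.  Mathematically: `Hom_G(Λ_Q(f_W) ⊗ ℚ_p, Ind(ω̃^{−b} ⊗ ω̃ᵇ)_{ℚ_p}) ≠ 0` — the tame principal series occurs in the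
`f_W`-part of `H₁(Y(K(p)K₀(M)), ℚ_p)`.  Equivalent to (I1⁰) (denominators clear on the finitely generated `Λ_Q`).  A closed
`Prop`, a ROUTE-POSITED HYPOTHESIS (not a published statement; no cite tag on purpose); asserts nothing. -/
def TamePrincipalSeriesFunctionalRat : Prop :=
  ∀ (p M : ℕ) [Fact p.Prime] [NeZero M] [NeZero (p ^ 2 * M)] (hpM : Nat.Coprime p M)
  [Fintype (diagTorus (ZMod p))] [Invertible (Fintype.card (diagTorus (ZMod p)) : ℤ_[p])]
  (W : WeierstrassCurve ℚ) [W.IsElliptic] [W.IsGloballyMinimal], W.conductorNorm ℤ = p ^ 2 * M →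
  ∀ D : ModularParametrizationData W (p ^ 2 * M), 11 ≤ p → Rank1Residual.Addv W p → Rank1Residual.Irr W p →
  Summit.BirchSwinnertonDyer.Rank1Residual.Additive.TypeGOrd W p → padicValInt p W.minimalDiscriminantInt ≤ 4 →
  ∃ Ψ : spreadLattice ℤ_[p] p M hpM D.f →ₗ[ℤ_[p]] (Option (ZMod p) → ℚ_[p]),
  IsEquivariantOnSpread ℤ_[p] p M hpM D.f
    (Literature.NumberTheory.Automorphic.TwistedQuotient.resScalars ℤ_[p]
      (coordRep (reduceChar ℚ_[p] (Kato2004.teichmullerChar p ^ (p - 1 - tameExponent p W)))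
        (reduceChar ℚ_[p] (Kato2004.teichmullerChar p ^ tameExponent p W)))) Ψ ∧
  Ψ ≠ 0

/-! ### Appended (g26, third): the GEOMETRIC form (I1ᴷ) — a nonzero equivariant map over SOME field `K ⊇ ℚ_p`

Typers state representation-theoretic facts over an algebraically closed field (`ℚ̄_p`, `ℂ_p`).  The Bruhat model of the
principal series is defined over `ℤ_p`, so a nonzero equivariant `K`-valued map on `Λ_Q(f_D)` for ANY field `K` over `ℚ_p`
pushes down to `ℚ_p` along a `ℚ_p`-linear functional `K → ℚ_p`
(`KOfPrincipalSeriesFunctional.tamePrincipalSeriesFunctionalRat_of_field`: (I1ᴷ) ⟹ (I1ℚ) ⟹ (I1⁰)).  One definition, asserting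
nothing. -/

/-- **A nonzero equivariant functional to the tame principal series over some field `K ⊇ ℚ_p`** (input (I1ᴷ) of the
K-line, the geometric form of (I1⁰)/(I1ℚ)): for every curve `W` of conductor `p²M` in the situation of K, with
`b = tameExponent p W`, there are a field `K` which is an algebra over `ℚ_p` (compatibly over `ℤ_p`) and a NONZERO `ℤ_p`-linear
map `Ψ` from the spread lattice `Λ_Q(f_D)` to the `K`-valued Bruhat model `coordRep(ω̃^{p−1−b}, ω̃ᵇ) ⊗ K` intertwining right
translation with the group action.  Mathematically: `Hom_G(Λ_Q(f_W) ⊗ K, Ind(ω̃^{−b} ⊗ ω̃ᵇ)_K) ≠ 0` for some (equivalently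
every) field `K ⊇ ℚ_p`, e.g. `K = ℚ̄_p`: the tame principal series occurs in the `f_W`-part of `H₁(Y(K(p)K₀(M)), ℚ̄_p)`
[local Langlands at `p` for the potentially ordinary curve + Eichler–Shimura at level `K(p)K₀(M)`].  A closed `Prop`, a
ROUTE-POSITED HYPOTHESIS (not a published statement; no cite tag on purpose); asserts nothing. -/
def TamePrincipalSeriesFunctionalOverField : Prop :=
  ∀ (p M : ℕ) [Fact p.Prime] [NeZero M] [NeZero (p ^ 2 * M)] (hpM : Nat.Coprime p M)
  [Fintype (diagTorus (ZMod p))] [Invertible (Fintype.card (diagTorus (ZMod p)) : ℤ_[p])]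
  (W : WeierstrassCurve ℚ) [W.IsElliptic] [W.IsGloballyMinimal], W.conductorNorm ℤ = p ^ 2 * M →
  ∀ D : ModularParametrizationData W (p ^ 2 * M), 11 ≤ p → Rank1Residual.Addv W p → Rank1Residual.Irr W p →
  Summit.BirchSwinnertonDyer.Rank1Residual.Additive.TypeGOrd W p → padicValInt p W.minimalDiscriminantInt ≤ 4 →
  ∃ (K : Type) (_ : Field K) (_ : Algebra ℤ_[p] K) (_ : Algebra ℚ_[p] K) (_ : IsScalarTower ℤ_[p] ℚ_[p] K)
    (Ψ : spreadLattice ℤ_[p] p M hpM D.f →ₗ[ℤ_[p]] (Option (ZMod p) → K)),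
  IsEquivariantOnSpread ℤ_[p] p M hpM D.f
    (Literature.NumberTheory.Automorphic.TwistedQuotient.resScalars ℤ_[p]
      (coordRep (reduceChar K (Kato2004.teichmullerChar p ^ (p - 1 - tameExponent p W)))
        (reduceChar K (Kato2004.teichmullerChar p ^ tameExponent p W)))) Ψ ∧
  Ψ ≠ 0

end Summit.BirchSwinnertonDyer.BirchSwinnertonDyer.Theorems.TeichmullerTwistDescent
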